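import Literature.AlgebraicTopology.Homotopy.SerreFibrationHardLefschetz
import Literature.AlgebraicTopology.Homotopy.SerreFibrationFlatFamilies
import Literature.AlgebraicTopology.Homotopy.ZeroCellBasepoints
import Literature.Geometry.Kaehler.LefschetzOperator
import Mathlib.LinearAlgebra.Dual.Lemmas
import HarnessLib

/-!
# Deligne's invariant cycle theorem for Serre fibrations (topological form of Voisin II, Thm. 4.18)

Topic `Literature/AlgebraicTopology/Homotopy`. Let `p : E → B` be a Serre fibration whose base has
the weak homotopy type of a Hausdorff CW complex, `K` a field and `η ∈ H²(E; K)` a class whose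
restriction to every fibre satisfies hard Lefschetz for the cap product (in homology, centred at
`n₀`, with `H_k(p⁻¹b; K) = 0` for `k > 2n₀`) — the situation of a projective submersion with the
class of a relatively ample line bundle (Deligne 1968; C. Voisin, *Hodge Theory and Complex
Algebraic Geometry II*, Def. 4.14, Thm. 4.15). Then **every flat family `y_b ∈ Hᵏ(p⁻¹b; K)` of
fibre classes (a global section of the local system `Rᵏ p_* K`) is the family of restrictions of
ONE class `z ∈ Hᵏ(E; K)`** (`exists_class_of_flat`): Voisin II, Thm. 4.18 ("the restriction map
`Hᵏ(X, ℚ) → H⁰(Y, Rᵏ φ_* ℚ)` is surjective"), proof of §4.3.1–4.3.2 via the degeneration of the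
Leray spectral sequence (Thm. 4.15) — here in the homological Leray–Serre form proved in the tree
(`SerreHardLefschetz.ker_map_eq_ker_map`, the edge theorem `ker(H_k(E₀) → H_k(E)) =
ker(H_k(E₀) → H_k(E₁))` for the skeletal filtration `E_s = p⁻¹Xˢ` of the pullback to a CW model
`X → B`), dualised over the field (`SerreFlat.range_cohomologyMap_eq_of_ker_eq`).

The proof: (1) over a CW base `X`, a flat family extends to a class on `E₁ = p⁻¹X¹`
(`exists_extension_oneSkeleton`): `X¹` is covered by the open collar neighbourhood
`D = X¹ ∖ ⋃ⱼ Φⱼ(‖y‖ ≤ ½)` of `X⁰` (which deformation retracts onto `X⁰`, so `Hᵏ(p⁻¹D) ≅ Hᵏ(p⁻¹X⁰)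
= ∏ᵥ Hᵏ(p⁻¹v)`) and the small open 1-cells `Φⱼ(‖y‖ < ¾)` (contractible, so `Hᵏ(p⁻¹Φⱼ(‖y‖ < ¾)) ≅
Hᵏ(p⁻¹Φⱼ0)`); the classes determined by `y` on these pieces agree on the overlaps (arcs) by the
rigidity of flat families along paths (`SerreFlat.propagate`), and glue by Mayer–Vietoris.
(2) The edge theorem, dualised, says that `w|_{E₀}` for `w ∈ Hᵏ(E₁)` is `z|_{E₀}` for some
`z ∈ Hᵏ(E)`; so `z|_{p⁻¹v} = y_v` at the `0`-cells, hence everywhere (every point is joined to a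
`0`-cell; rigidity along paths) — `exists_class_of_flat_cw`. (3) For a general base, pull back to a
CW model `h : X → B` (a weak equivalence; `h^*E → E` is then a weak equivalence, Spanier 9.2.17) and
propagate from the points `h x` along paths — `exists_class_of_flat`.

(4) Two complements used by the algebro-geometric discharge: `capHardLefschetz_of_hasHardLefschetzProperty`
— hard Lefschetz passes from the cup product (`HasHardLefschetzProperty`, Voisin I Thm. 6.25) to the
cap product over a field (the iterated cap is the transpose of `Lⁱ` under the bijective Kronecker
maps, Hatcher Thm. 3.2 and p. 241); and `exists_class_of_flat_of_cover` — the theorem for a base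
covered by pairwise disjoint open pieces each with a CW model (e.g. the equidimensional pieces of
the complex points of a smooth variety), glued over the clopen partition `{p⁻¹Bᵢ}` of `E`.

Everything is proved; no named fact.

## References

* P. Deligne, *Théorème de Lefschetz et critères de dégénérescence de suites spectrales*, Publ.
  Math. IHÉS 35 (1968), Thm. 1.5, (2.4), Prop. 2.1. [Deligne1968]
* C. Voisin, *Hodge Theory and Complex Algebraic Geometry II*, CUP (2003), Def. 4.14, Thm. 4.15,
  §4.3.1, Lemma 4.17, Thm. 4.18. [VoisinHodgeII2003]
* E. H. Spanier, *Algebraic Topology*, Springer (1981), Ch. 9 Sec. 2 Lemma 2, Thm. 17. [Spanier1981]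
* A. Hatcher, *Algebraic Topology*, CUP (2002), §3.1 Thm. 3.2 (p. 198), pp. 201–204, §3.3 p. 241.
  [HatcherAT2002]
* C. Voisin, *Hodge Theory and Complex Algebraic Geometry I*, CUP (2002), Thm. 6.25. [VoisinHodgeI2002]
-/

noncomputable section

open Set Function Metric CategoryTheory
open scoped Topology unitInterval
open Literature.AlgebraicTopology.SingularHomology Literature.Algebra.Homology Literature.Geometry.Kaehler

namespace Literature.AlgebraicTopology.Homotopy

universe u

namespace SerreInvariantCycles

open _root_.Topology RelCWComplex SkeletonCollar CellsDirectSum SerreFlat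

/-! ### Geometry of the cells: relatively open images, contractible pieces, the open collar -/

section Geometry

variable {X : Type u} [TopologicalSpace X] [T2Space X] [CWComplex (univ : Set X)] {s : ℕ}

/-- `Φⱼ(T) = eⱼ ∖ Φⱼ(D̄ ∖ T)` for `T` inside the open ball (injectivity of `Φⱼ` on the open ball, and
`Φⱼ(∂D) ∩ eⱼ = ∅`). [folklore] -/
theorem image_eq_openCell_diff (j : cell (univ : Set X) s) {T : Set (Fin s → ℝ)} (hT1 : T ⊆ ball 0 1) :
    map s j '' T = openCell s j \ map s j '' (closedBall 0 1 \ T) := by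
  ext x
  constructor
  · rintro ⟨y, hy, rfl⟩
    refine ⟨map_mem_openCell j (hT1 hy), ?_⟩
    rintro ⟨y', ⟨hy'1, hy'T⟩, h⟩
    have := SerreCell.eq_of_map_eq_map_of_norm_lt (mem_ball_zero_iff.1 (hT1 hy))
      (mem_closedBall_zero_iff.1 hy'1) h
    exact hy'T (this ▸ hy)
  · rintro ⟨⟨y, hy, rfl⟩, hx⟩
    refine ⟨y, ?_, rfl⟩
    by_contra hyT
    exact hx ⟨y, ⟨ball_subset_closedBall hy, hyT⟩, rfl⟩

/-- **The image `Φⱼ(T)` of an open subset `T` of the open ball is open in the skeleton `Xˢ`**: it is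
`Xˢ ∩ W` for an open `W ⊆ X` (the complement of the compact `Φⱼ(D̄ ∖ T)` and of the closed
`Xˢ ∖ eⱼ`). [folklore] -/
theorem exists_isOpen_inter_eq_image (j : cell (univ : Set X) s) {T : Set (Fin s → ℝ)} (hT : IsOpen T)
    (hT1 : T ⊆ ball 0 1) :
    ∃ W : Set X, IsOpen W ∧ (skeletonLT (univ : Set X) ((s : ℕ∞) + 1) : Set X) ∩ W = map s j '' T := by
  have hc1 : IsClosed (map s j '' (closedBall 0 1 \ T)) :=
    (((isCompact_closedBall (0 : Fin s → ℝ) 1).diff hT).image_of_continuousOn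
      ((continuousOn s j).mono Set.sdiff_subset)).isClosed
  have hc2 : IsClosed ((skeletonLT (univ : Set X) ((s : ℕ∞) + 1) : Set X) \ openCell s j) := by
    have h := isClosed_skeletonLT_diff_openCell s j
    rwa [Nat.cast_succ] at h
  refine ⟨(map s j '' (closedBall 0 1 \ T))ᶜ ∩ ((skeletonLT (univ : Set X) ((s : ℕ∞) + 1) : Set X) \ openCell s j)ᶜ,
    hc1.isOpen_compl.inter hc2.isOpen_compl, ?_⟩
  rw [image_eq_openCell_diff j hT1]
  ext x
  simp only [mem_inter_iff, mem_compl_iff, Set.mem_sdiff, not_and, not_not]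
  constructor
  · rintro ⟨hx, h1, h2⟩
    exact ⟨h2 hx, h1⟩
  · rintro ⟨hx, h1⟩
    exact ⟨openCell_subset_skeletonLT s j hx, h1, fun _ => hx⟩

omit [T2Space X] in
/-- Images of subsets of the open balls of distinct cells are disjoint. [folklore] -/
theorem disjoint_image_of_ne {j j' : cell (univ : Set X) s} (hne : j ≠ j') {T T' : Set (Fin s → ℝ)}
    (hT : T ⊆ ball 0 1) (hT' : T' ⊆ ball 0 1) : Disjoint (map s j '' T) (map s j' '' T') :=
  Set.disjoint_left.2 fun _ ⟨_, hy, hx⟩ ⟨_, hy', hx'⟩ =>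
    hne (eq_of_mem_openCell (hx ▸ map_mem_openCell j (hT hy)) (hx' ▸ map_mem_openCell j' (hT' hy')))

/-- **`Φⱼ(C)` is contractible for a nonempty convex `C` inside a closed ball of radius `< 1`**
(`Φⱼ` embeds such a ball). [folklore] -/
theorem contractibleSpace_image (j : cell (univ : Set X) s) {C : Set (Fin s → ℝ)} (hC : Convex ℝ C)
    (hne : C.Nonempty) {r : ℝ} (hr : r < 1) (hCr : C ⊆ closedBall 0 r) :
    ContractibleSpace ↥(map s j '' C) := by
  haveI : CompactSpace ↥(closedBall (0 : Fin s → ℝ) r) := isCompact_iff_compactSpace.1 (isCompact_closedBall _ _)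
  have hemb : IsClosedEmbedding (SerreCell.cellChar j hr.le) :=
    (SerreCell.cellChar j hr.le).continuous.isClosedEmbedding fun a b h =>
      Subtype.ext (SerreCell.injOn_closedBall j hr a.2 b.2 h)
  let C' : Set ↥(closedBall (0 : Fin s → ℝ) r) := Subtype.val ⁻¹' C
  have hemb' : IsEmbedding (SerreCell.cellChar j hr.le ∘ (Subtype.val : C' → _)) :=
    hemb.isEmbedding.comp IsEmbedding.subtypeVal
  have hrange : range (SerreCell.cellChar j hr.le ∘ (Subtype.val : C' → _)) = map s j '' C := by
    ext x
    constructor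
    · rintro ⟨z, rfl⟩
      exact ⟨z.1.1, z.2, rfl⟩
    · rintro ⟨y, hy, rfl⟩
      exact ⟨⟨⟨y, hCr hy⟩, hy⟩, rfl⟩
  let e1 : ↥C' ≃ₜ ↥(map s j '' C) := hemb'.toHomeomorph.trans (Homeomorph.setCongr hrange)
  let e2 : ↥C' ≃ₜ ↥C := preimageValHomeomorphOfSubset hCr
  haveI : ContractibleSpace ↥C := hC.contractibleSpace hne
  haveI : ContractibleSpace ↥C' := e2.contractibleSpace
  exact e1.symm.contractibleSpace

omit [T2Space X] in
/-- The path `t ↦ Φⱼ((1-t) y₀ + t y₁)` along a segment of the closed ball. [folklore] -/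
theorem exists_path_segment (j : cell (univ : Set X) s) {y₀ y₁ : Fin s → ℝ}
    (hy₀ : y₀ ∈ closedBall (0 : Fin s → ℝ) 1) (hy₁ : y₁ ∈ closedBall (0 : Fin s → ℝ) 1) :
    ∃ γ : C(I, X), ∀ t : I, γ t = map s j ((1 - (t : ℝ)) • y₀ + (t : ℝ) • y₁) := by
  have hmem : ∀ t : I, (1 - (t : ℝ)) • y₀ + (t : ℝ) • y₁ ∈ closedBall (0 : Fin s → ℝ) 1 := fun t =>
    (convex_closedBall (0 : Fin s → ℝ) 1) hy₀ hy₁ (sub_nonneg.2 t.2.2) t.2.1 (by ring)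
  refine ⟨⟨fun t => map s j ((1 - (t : ℝ)) • y₀ + (t : ℝ) • y₁), ?_⟩, fun t => rfl⟩
  refine (continuousOn s j).comp_continuous (by fun_prop) hmem

/-- For `y : ℝ¹`, `‖y‖ = |y 0|`. [folklore] -/
theorem norm_fin_one (y : Fin 1 → ℝ) : ‖y‖ = |y 0| := by
  rw [Pi.norm_def]
  have : (Finset.univ : Finset (Fin 1)) = {0} := Finset.univ_unique
  rw [this, Finset.sup_singleton, coe_nnnorm, Real.norm_eq_abs]

/-! ### The open collar `D = Xˢ ∖ ⋃ⱼ Φⱼ(‖y‖ ≤ ½)` -/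

/-- `Φⱼ y ∈ D` for `½ < ‖y‖ ≤ 1`. [folklore] -/
theorem map_mem_D (j : cell (univ : Set X) s) {y : Fin s → ℝ} (hy : 2⁻¹ < ‖y‖) (hy1 : ‖y‖ ≤ 1) :
    map s j y ∈ (skeletonLT (univ : Set X) ((s : ℕ∞) + 1) : Set X) \
      ⋃ j' : cell (univ : Set X) s, map s j' '' closedBall (0 : Fin s → ℝ) 2⁻¹ := by
  refine ⟨closedCell_subset_skeletonLT s j (map_mem_closedCell j (mem_closedBall_zero_iff.2 hy1)), ?_⟩
  rintro h
  obtain ⟨j', y', hy', h'⟩ := mem_iUnion.1 h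
  have hy'1 : y' ∈ ball (0 : Fin s → ℝ) 1 := closedBall_subset_ball (by norm_num) hy'
  rcases hy1.lt_or_eq with h1 | h1
  · obtain ⟨-, rfl⟩ := eq_of_map_eq_map hy'1 (mem_ball_zero_iff.2 h1) h'
    exact absurd (mem_closedBall_zero_iff.1 hy') (not_le.2 hy)
  · exact not_mem_openCell_of_mem_skeletonLT
      (cellFrontier_subset_skeletonLT s j (h' ▸ map_mem_cellFrontier j h1 : map s j' y' ∈ _)) j'
      (map_mem_openCell j' hy'1)

/-- The strict lower bound `½ < ‖radial t y‖` on `½ < ‖y‖ ≤ 1`. [folklore] -/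
theorem half_lt_norm_radial {t : ℝ} (ht0 : 0 ≤ t) (ht1 : t ≤ 1) {y : Fin s → ℝ} (hy : 2⁻¹ < ‖y‖)
    (hy1 : ‖y‖ ≤ 1) : 2⁻¹ < ‖radial t y‖ := by
  rw [norm_radial_of_le ht0 ht1 hy.le]
  nlinarith

/-- The push preserves `D`. [folklore] -/
theorem push_mem_D {t : ℝ} (ht0 : 0 ≤ t) (ht1 : t ≤ 1) {x : X}
    (hx : x ∈ (skeletonLT (univ : Set X) ((s : ℕ∞) + 1) : Set X) \
      ⋃ j' : cell (univ : Set X) s, map s j' '' closedBall (0 : Fin s → ℝ) 2⁻¹) :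
    push s t x ∈ (skeletonLT (univ : Set X) ((s : ℕ∞) + 1) : Set X) \
      ⋃ j' : cell (univ : Set X) s, map s j' '' closedBall (0 : Fin s → ℝ) 2⁻¹ := by
  rcases mem_skeletonLT_succ_iff.1 hx.1 with h | ⟨j, y, hy, rfl⟩
  · rw [push_of_mem_skeletonLT t h]; exact hx
  · have hy2 : 2⁻¹ < ‖y‖ := by
      by_contra hle
      exact hx.2 (mem_iUnion.2 ⟨j, y, mem_closedBall_zero_iff.2 (not_lt.1 hle), rfl⟩)
    rw [push_map_of_mem_ball t j hy]
    exact map_mem_D j (half_lt_norm_radial ht0 ht1 hy2 (mem_ball_zero_iff.1 hy).le)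
      (half_le_norm_radial ht0 ht1 hy2.le (mem_ball_zero_iff.1 hy).le).2

/-- **`Xˢ⁻¹` is a strong deformation retract of the open collar `D = Xˢ ∖ ⋃ⱼ Φⱼ(‖y‖ ≤ ½)`** (the
radial push; Spanier Ch. 9 Sec. 2, proof of Lemma 2; Hatcher, proof of Lemma 2.34).
[cite: Spanier1981, Ch. 9 Sec. 2 Lemma 2 (proof)] -/
theorem isStrongDeformationRetractOf_D :
    IsStrongDeformationRetractOf (skeletonLT (univ : Set X) (s : ℕ∞) : Set X)
      ((skeletonLT (univ : Set X) ((s : ℕ∞) + 1) : Set X) \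
        ⋃ j' : cell (univ : Set X) s, map s j' '' closedBall (0 : Fin s → ℝ) 2⁻¹) := by
  refine IsStrongDeformationRetractOf.of_continuousOn (fun t x => push s t x) ?_
    (fun t ht x hx => push_mem_D ht.1 ht.2 hx) (fun x _ => push_zero x)
    (fun x hx => push_one_mem (diff_iUnion_subset_collar hx))
    (fun t _ x _ hx => push_of_mem_skeletonLT t hx)
  rw [continuousOn_iff_continuous_restrict]
  have h := continuous_push_prod (X := X) (s := s)
  have hfac : (Icc (0 : ℝ) 1 ×ˢ ((skeletonLT (univ : Set X) ((s : ℕ∞) + 1) : Set X) \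
      ⋃ j' : cell (univ : Set X) s, map s j' '' closedBall (0 : Fin s → ℝ) 2⁻¹)).restrict
        (fun q : ℝ × X => push s q.1 q.2) =
      (fun q : ↥(skeletonLT (univ : Set X) ((s : ℕ∞) + 1) : Set X) × I => push s q.2 (q.1 : X)) ∘
        fun z => (⟨z.1.2, z.2.2.1⟩, ⟨z.1.1, z.2.1⟩) := rfl
  rw [hfac]
  exact h.comp (by fun_prop)

end Geometry

/-! ### Extension of a flat family over `E₁ = p⁻¹X¹` -/

section OneSkeleton

variable (K : Type u) [Field K]
variable {X : Type u} [TopologicalSpace X] [T2Space X] [CWComplex (univ : Set X)]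
variable {E : Type u} [TopologicalSpace E] {p : E → X} (hp : IsSerreFibration p) {k : ℕ}
  (y : ∀ x : X, singularCohomology K K ↥(p ⁻¹' {x}) k)
  (hy : ∀ x₀ : X, ∃ V ∈ 𝓝 x₀, ∃ g : singularCohomology K K ↥(p ⁻¹' V) k, ∀ (x : X) (hx : x ∈ V),
    singularCohomology.map K K (subsetInclusion (fibre_subset_preimage hx)) k g = y x)

omit [TopologicalSpace X] [T2Space X] [CWComplex (univ : Set X)] in
/-- Restriction from `p⁻¹C'` to `p⁻¹C` to a fibre is restriction from `p⁻¹C'` to the fibre.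
[folklore] -/
theorem res_res {C C' : Set X} (hCC' : C ⊆ C') {b : X} (hb : b ∈ C)
    (z : singularCohomology K K ↥(p ⁻¹' C') k) :
    singularCohomology.map K K (subsetInclusion (fibre_subset_preimage hb)) k
        (singularCohomology.map K K (subsetInclusion (preimage_mono hCC')) k z) =
      singularCohomology.map K K (subsetInclusion (fibre_subset_preimage (hCC' hb))) k z := by
  rw [← ModuleCat.comp_apply, ← singularCohomology.map_comp]; rfl

omit [TopologicalSpace X] [T2Space X] [CWComplex (univ : Set X)] in
/-- Restriction from `p⁻¹C'` to `p⁻¹C` to `p⁻¹C''`. [folklore] -/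
theorem res_res' {C C' C'' : Set X} (hCC' : C ⊆ C') (hC''C : C'' ⊆ C)
    (z : singularCohomology K K ↥(p ⁻¹' C') k) :
    singularCohomology.map K K (subsetInclusion (preimage_mono hC''C)) k
        (singularCohomology.map K K (subsetInclusion (preimage_mono hCC')) k z) =
      singularCohomology.map K K (subsetInclusion (preimage_mono (hC''C.trans hCC'))) k z := by
  rw [← ModuleCat.comp_apply, ← singularCohomology.map_comp]; rfl

include hp hy in
/-- **A flat family determines a compatible class over every small open cell `Φⱼ(‖y‖ < ¾)`**: the
piece is contractible, so its fibre inclusions are weak equivalences; take the class extending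
`y` at the centre and propagate along radial paths. [cite: VoisinHodgeII2003, §4.3.1] -/
theorem exists_class_smallBall {s : ℕ} (j : cell (univ : Set X) s) :
    ∃ Y : singularCohomology K K ↥(p ⁻¹' (map s j '' ball (0 : Fin s → ℝ) (3 / 4))) k,
      ∀ (b : X) (hb : b ∈ map s j '' ball (0 : Fin s → ℝ) (3 / 4)),
        singularCohomology.map K K (subsetInclusion (fibre_subset_preimage hb)) k Y = y b := by
  have hsub : ball (0 : Fin s → ℝ) (3 / 4) ⊆ closedBall 0 (7 / 8) :=
    ball_subset_closedBall.trans (closedBall_subset_closedBall (by norm_num))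
  haveI : ContractibleSpace ↥(map s j '' ball (0 : Fin s → ℝ) (3 / 4)) :=
    contractibleSpace_image j (convex_ball 0 _) ⟨0, mem_ball_self (by norm_num)⟩ (by norm_num) hsub
  have hc : map s j 0 ∈ map s j '' ball (0 : Fin s → ℝ) (3 / 4) := ⟨0, mem_ball_self (by norm_num), rfl⟩
  obtain ⟨Y, hY⟩ := (bijective_res_singleton K hp hc k).2 (y (map s j 0))
  refine ⟨Y, fun b hb => ?_⟩
  obtain ⟨y₁, hy₁, rfl⟩ := hb
  obtain ⟨γ, hγ⟩ := exists_path_segment j (mem_closedBall_self zero_le_one)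
    (ball_subset_closedBall (ball_subset_ball (by norm_num) hy₁))
  have hγmem : ∀ t : I, γ t ∈ map s j '' ball (0 : Fin s → ℝ) (3 / 4) := fun t => by
    rw [hγ t]
    refine ⟨_, ?_, rfl⟩
    rw [smul_zero, zero_add, mem_ball_zero_iff, norm_smul, Real.norm_eq_abs, abs_of_nonneg t.2.1]
    exact lt_of_le_of_lt (mul_le_of_le_one_left (norm_nonneg _) t.2.2) (mem_ball_zero_iff.1 hy₁)
  have e0 : γ 0 = map s j 0 := by rw [hγ 0]; simp
  have e1 : γ 1 = map s j y₁ := by rw [hγ 1]; simp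
  have h0 := (res_eq_iff_of_eq K Y y (hγmem 0) hc e0).2 hY
  exact (res_eq_iff_of_eq K Y y (hγmem 1) ⟨y₁, hy₁, rfl⟩ e1).1 (propagate K hp Y y hy γ hγmem h0 1)

include hp hy in
/-- **Extension of a flat family over the `1`-skeleton**: there is a class `w ∈ Hᵏ(p⁻¹X¹; K)`
restricting to `y_v` on the fibre over every point `v` of the `0`-skeleton (Mayer–Vietoris for the
cover of `X¹` by the open collar of `X⁰` and the small open `1`-cells; the pieces agree on the
overlapping arcs by rigidity along paths). [cite: VoisinHodgeII2003, Thm. 4.18 (proof, §4.3.1–4.3.2)]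
[cite: HatcherAT2002, §3.1 pp. 203–204] -/
theorem exists_extension_oneSkeleton :
    ∃ w : singularCohomology K K ↥(tot p 1) k,
      ∀ (v : X) (hv : v ∈ (skeletonLT (univ : Set X) ((1 : ℕ) : ℕ∞) : Set X)),
        singularCohomology.map K K (subsetInclusion
          (fibre_subset_preimage (skeletonLT_mono (by exact_mod_cast Nat.le_succ 1) hv) :
            p ⁻¹' {v} ⊆ tot p 1)) k w = y v := by
  -- notation
  set X0 : Set X := (skeletonLT (univ : Set X) ((1 : ℕ) : ℕ∞) : Set X) with hX0
  set X1 : Set X := (skeletonLT (univ : Set X) (((1 : ℕ) : ℕ∞) + 1) : Set X) with hX1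
  set D : Set X := X1 \ ⋃ j : cell (univ : Set X) 1, map 1 j '' closedBall (0 : Fin 1 → ℝ) 2⁻¹ with hD
  let Bj : cell (univ : Set X) 1 → Set X := fun j => map 1 j '' ball (0 : Fin 1 → ℝ) (3 / 4)
  set Bs : Set X := ⋃ j, Bj j with hBs
  have h01 : X0 ⊆ X1 := skeletonLT_mono (by exact_mod_cast Nat.le_succ 1)
  have hX0D : X0 ⊆ D := skeletonLT_subset_diff_iUnion
  have hDX1 : D ⊆ X1 := Set.sdiff_subset
  have hb34 : ball (0 : Fin 1 → ℝ) (3 / 4) ⊆ ball 0 1 := ball_subset_ball (by norm_num)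
  have hBjX1 : ∀ j, Bj j ⊆ X1 := fun j => (image_mono hb34).trans (openCell_subset_skeletonLT 1 j)
  have hBsX1 : Bs ⊆ X1 := iUnion_subset hBjX1
  -- (1) the class on `p⁻¹D`
  -- `Hᵏ(p⁻¹D) → Hᵏ(p⁻¹X⁰)` is bijective, and `Hᵏ(p⁻¹X⁰) → ∏ᵥ Hᵏ(p⁻¹v)` is bijective (X⁰ discrete)
  have hsurjD := (bijective_res_of_isStrongDeformationRetractOf K hp hX0D isStrongDeformationRetractOf_D k).2
  have hX0e : (skeletonLT (univ : Set X) (((0 : ℕ) : ℕ∞) + 1) : Set X) = X0 := by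
    rw [hX0]; norm_num
  have hX0pieces : ∀ v : ↥X0, ∃ W : Set X, IsOpen W ∧ ({(v : X)} : Set X) = X0 ∩ W := by
    intro v
    have hv : (v : X) ∈ (skeletonLT (univ : Set X) (((0 : ℕ) : ℕ∞) + 1) : Set X) := by
      rw [hX0e]; exact v.2
    rcases mem_skeletonLT_succ_iff.1 hv with h | ⟨j, y₀, hy₀, hvj⟩
    · simp [RelCWComplex.skeletonLT_zero_eq_base] at h
    · obtain ⟨W, hWo, hW⟩ := exists_isOpen_inter_eq_image j isOpen_ball (subset_refl (ball (0 : Fin 0 → ℝ) 1))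
      refine ⟨W, hWo, ?_⟩
      have hXW : X0 ∩ W = (skeletonLT (univ : Set X) (((0 : ℕ) : ℕ∞) + 1) : Set X) ∩ W := by rw [hX0e]
      rw [hXW, hW, hvj]
      ext x
      simp only [mem_singleton_iff, mem_image]
      constructor
      · rintro rfl; exact ⟨y₀, hy₀, rfl⟩
      · rintro ⟨y', -, rfl⟩; rw [Subsingleton.elim y' y₀]
  obtain ⟨Y0, hY0⟩ := exists_forall_res_eq K (O := p ⁻¹' X0) (P := fun v : ↥X0 => p ⁻¹' {(v : X)})
    (fun v => fibre_subset_preimage v.2)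
    (fun v => by
      obtain ⟨W, hWo, hW⟩ := hX0pieces v
      exact ⟨p ⁻¹' W, hWo.preimage hp.continuous, by rw [← preimage_inter, ← hW]⟩)
    (fun v v' hne => Disjoint.preimage p (disjoint_singleton.2 fun h => hne (Subtype.ext h)))
    (fun e he => mem_iUnion.2 ⟨⟨p e, he⟩, rfl⟩) (fun v => y v)
  obtain ⟨YD, hYD⟩ := hsurjD Y0
  have hYDv : ∀ (v : X) (hv : v ∈ X0),
      singularCohomology.map K K (subsetInclusion (fibre_subset_preimage (hX0D hv))) k YD = y v := by
    intro v hv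
    rw [← res_res K hX0D hv YD, hYD]
    exact hY0 ⟨v, hv⟩
  -- `YD` restricts to `y` on every fibre over `Φⱼ y`, `½ < |y 0| < 1`, by propagation from `Φⱼ(±1)`
  have hYDarc : ∀ (j : cell (univ : Set X) 1) (y₁ : Fin 1 → ℝ) (h1 : 2⁻¹ < ‖y₁‖) (h2 : ‖y₁‖ < 1),
      singularCohomology.map K K (subsetInclusion (fibre_subset_preimage (map_mem_D j h1 h2.le))) k YD =
        y (map 1 j y₁) := by
    intro j y₁ h1 h2
    -- the end point `ε = sign (y₁ 0)`, `Φⱼ ε ∈ X⁰`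
    let ε : ℝ := if 0 ≤ y₁ 0 then 1 else -1
    have hε : ε * y₁ 0 = ‖y₁‖ := by
      rw [norm_fin_one]
      by_cases h : 0 ≤ y₁ 0
      · simp [ε, h, abs_of_nonneg h]
      · simp [ε, h, abs_of_neg (not_le.1 h)]
    have hε1 : |ε| = 1 := by by_cases h : 0 ≤ y₁ 0 <;> simp [ε, h]
    let y₀ : Fin 1 → ℝ := fun _ => ε
    have hy₀ : ‖y₀‖ = 1 := by rw [norm_fin_one]; exact hε1
    obtain ⟨γ, hγ⟩ := exists_path_segment j (mem_closedBall_zero_iff.2 hy₀.le) (mem_closedBall_zero_iff.2 h2.le)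
    -- along the segment, `½ < ‖·‖ ≤ 1`
    have hseg : ∀ t : I, 2⁻¹ < ‖(1 - (t : ℝ)) • y₀ + (t : ℝ) • y₁‖ ∧ ‖(1 - (t : ℝ)) • y₀ + (t : ℝ) • y₁‖ ≤ 1 := by
      intro t
      have ht0 : (0 : ℝ) ≤ t := t.2.1
      have ht1 : (t : ℝ) ≤ 1 := t.2.2
      have hval : ‖(1 - (t : ℝ)) • y₀ + (t : ℝ) • y₁‖ = (1 - (t : ℝ)) + (t : ℝ) * ‖y₁‖ := by
        rw [norm_fin_one]
        have : ((1 - (t : ℝ)) • y₀ + (t : ℝ) • y₁) 0 = ε * ((1 - (t : ℝ)) + (t : ℝ) * (ε * y₁ 0)) := by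
          have hε2 : ε * ε = 1 := by by_cases h : 0 ≤ y₁ 0 <;> simp [ε, h]
          simp only [Pi.add_apply, Pi.smul_apply, smul_eq_mul, y₀]
          linear_combination (-(t : ℝ) * y₁ 0) * hε2
        rw [this, abs_mul, hε1, one_mul, hε]
        exact abs_of_nonneg (by nlinarith [norm_nonneg y₁])
      rw [hval]
      constructor
      · nlinarith [mul_nonneg (sub_nonneg.2 ht1) (sub_nonneg.2 h2.le)]
      · nlinarith [mul_nonneg ht0 (sub_nonneg.2 h2.le)]
    have hγD : ∀ t : I, γ t ∈ D := fun t => by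
      rw [hγ t]; exact map_mem_D j (hseg t).1 (hseg t).2
    have e0 : γ 0 = map 1 j y₀ := by rw [hγ 0]; simp
    have e1 : γ 1 = map 1 j y₁ := by rw [hγ 1]; simp
    have hv : map 1 j y₀ ∈ X0 := cellFrontier_subset_skeletonLT 1 j (map_mem_cellFrontier j hy₀)
    have h0 := (res_eq_iff_of_eq K YD y (hγD 0) (hX0D hv) e0).2 (hYDv _ hv)
    exact (res_eq_iff_of_eq K YD y (hγD 1) (map_mem_D j h1 h2.le) e1).1 (propagate K hp YD y hy γ hγD h0 1)
  -- (2) the classes on the small cells, glued over `p⁻¹Bs`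
  have hBj : ∀ j, ∃ Y : singularCohomology K K ↥(p ⁻¹' Bj j) k, ∀ (b : X) (hb : b ∈ Bj j),
      singularCohomology.map K K (subsetInclusion (fibre_subset_preimage hb)) k Y = y b :=
    fun j => exists_class_smallBall K hp y hy j
  choose Yj hYj using hBj
  have hBjBs : ∀ j, Bj j ⊆ Bs := fun j => subset_iUnion Bj j
  obtain ⟨YB, hYB⟩ := exists_forall_res_eq K (O := p ⁻¹' Bs) (P := fun j => p ⁻¹' Bj j)
    (fun j => preimage_mono (hBjBs j))
    (fun j => by
      obtain ⟨W, hWo, hW⟩ := exists_isOpen_inter_eq_image j isOpen_ball hb34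
      refine ⟨p ⁻¹' W, hWo.preimage hp.continuous, ?_⟩
      rw [← preimage_inter]; congr 1
      rw [← inter_eq_right.2 hBsX1, inter_assoc, inter_left_comm, hW, inter_eq_right.2 (hBjBs j)])
    (fun j j' hne => (disjoint_image_of_ne hne hb34 hb34).preimage p)
    (fun e he => by obtain ⟨j, hj⟩ := mem_iUnion.1 he; exact mem_iUnion.2 ⟨j, hj⟩) Yj
  have hYBb : ∀ (b : X) (hb : b ∈ Bs),
      singularCohomology.map K K (subsetInclusion (fibre_subset_preimage hb)) k YB = y b := by
    intro b hb
    obtain ⟨j, hbj⟩ := mem_iUnion.1 hb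
    rw [← res_res K (hBjBs j) hbj YB, hYB j]
    exact hYj j b hbj
  -- (3) agreement on `p⁻¹D ∩ p⁻¹Bs`, piece by piece over the arcs `Φⱼ(½ < ±y 0 < ¾)`
  let sg : Bool → ℝ := fun b => if b then 1 else -1
  let S : Bool → Set (Fin 1 → ℝ) := fun b => (fun y : Fin 1 → ℝ => sg b * y 0) ⁻¹' Ioo 2⁻¹ (3 / 4)
  have hsg : ∀ b, |sg b| = 1 := fun b => by cases b <;> simp [sg]
  have hSnorm : ∀ b, ∀ y ∈ S b, ‖y‖ = sg b * y 0 := fun b y hy => by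
    rw [norm_fin_one]
    have h : 0 < sg b * y 0 := lt_trans (by norm_num) hy.1
    cases b
    · simp only [sg, Bool.false_eq_true, ↓reduceIte, neg_mul, one_mul] at h ⊢
      exact abs_of_neg (by linarith)
    · simp only [sg, ↓reduceIte, one_mul] at h ⊢
      exact abs_of_pos h
  have hSball : ∀ b, S b ⊆ ball 0 1 := fun b y hy => by
    rw [mem_ball_zero_iff, hSnorm b y hy]; linarith [hy.2]
  have hSopen : ∀ b, IsOpen (S b) := fun b =>
    isOpen_Ioo.preimage (continuous_const.mul (continuous_apply 0))
  have hSconv : ∀ b, Convex ℝ (S b) := fun b =>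
    (convex_Ioo (2⁻¹ : ℝ) (3 / 4)).is_linear_preimage
      ⟨fun y₁ y₂ => by simp only [Pi.add_apply, mul_add], fun c y₁ => by
        simp only [Pi.smul_apply, smul_eq_mul]; ring⟩
  have hSr : ∀ b, S b ⊆ closedBall 0 (3 / 4) := fun b y hy =>
    ball_subset_closedBall (by rw [mem_ball_zero_iff, hSnorm b y hy]; exact hy.2)
  have hmid : ∀ b, (fun _ => sg b * (5 / 8) : Fin 1 → ℝ) ∈ S b := fun b => by
    have h2 : sg b * sg b = 1 := by cases b <;> simp [sg]
    constructor <;> nlinarith [h2]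
  -- the pieces `Φⱼ(S b)` of `D ∩ Bs`
  let P : cell (univ : Set X) 1 × Bool → Set X := fun q => map 1 q.1 '' S q.2
  have hPD : ∀ q, P q ⊆ D := fun q => by
    rintro _ ⟨y₁, hy₁, rfl⟩
    have hn := hSnorm q.2 y₁ hy₁
    exact map_mem_D q.1 (by rw [hn]; exact hy₁.1) (by rw [hn]; linarith [hy₁.2])
  have hPBs : ∀ q, P q ⊆ Bs := fun q =>
    (image_mono fun y₁ hy₁ => by rw [mem_ball_zero_iff, hSnorm q.2 y₁ hy₁]; exact hy₁.2).trans (hBjBs q.1)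
  set O : Set E := p ⁻¹' D ∩ p ⁻¹' Bs with hO
  have hPO : ∀ q, p ⁻¹' P q ⊆ O := fun q => subset_inter (preimage_mono (hPD q)) (preimage_mono (hPBs q))
  have hPopen : ∀ q, ∃ W : Set E, IsOpen W ∧ p ⁻¹' P q = O ∩ W := fun q => by
    obtain ⟨W, hWo, hW⟩ := exists_isOpen_inter_eq_image q.1 (hSopen q.2) (hSball q.2)
    refine ⟨p ⁻¹' W, hWo.preimage hp.continuous, ?_⟩
    ext e
    simp only [hO, mem_inter_iff, mem_preimage]
    constructor
    · intro he
      have he' : p e ∈ X1 ∩ W := by rw [hW]; exact he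
      exact ⟨⟨hPD q he, hPBs q he⟩, he'.2⟩
    · rintro ⟨⟨heD, -⟩, heW⟩
      show p e ∈ map 1 q.1 '' S q.2
      rw [← hW]; exact ⟨hDX1 heD, heW⟩
  have hPdisj : ∀ q q', q ≠ q' → Disjoint (p ⁻¹' P q) (p ⁻¹' P q') := by
    rintro ⟨j, b⟩ ⟨j', b'⟩ hne
    refine Disjoint.preimage p ?_
    by_cases hj : j = j'
    · subst hj
      have hb : b ≠ b' := fun h => hne (by rw [h])
      refine Set.disjoint_left.2 ?_
      rintro _ ⟨y₁, hy₁, rfl⟩ ⟨y₂, hy₂, h⟩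
      have heq : y₂ = y₁ := map_injOn j (hSball b' hy₂) (hSball b hy₁) h
      subst heq
      have h1 := hy₁.1; have h2 := hy₂.1
      cases b <;> cases b' <;> simp [sg] at hb h1 h2 <;> linarith
    · exact disjoint_image_of_ne hj (hSball b) (hSball b')
  have hPcov : O ⊆ ⋃ q, p ⁻¹' P q := by
    rintro e ⟨heD, heB⟩
    obtain ⟨j, y₁, hy₁, hje⟩ : ∃ j y₁, y₁ ∈ ball (0 : Fin 1 → ℝ) (3 / 4) ∧ map 1 j y₁ = p e := by
      obtain ⟨j, hj⟩ := mem_iUnion.1 heB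
      obtain ⟨y₁, hy₁, h⟩ := hj
      exact ⟨j, y₁, hy₁, h⟩
    have hhalf : 2⁻¹ < ‖y₁‖ := by
      by_contra hle
      exact heD.2 (mem_iUnion.2 ⟨j, y₁, mem_closedBall_zero_iff.2 (not_lt.1 hle), hje⟩)
    let b : Bool := decide (0 ≤ y₁ 0)
    have hsg' : sg b * y₁ 0 = ‖y₁‖ := by
      rw [norm_fin_one]
      by_cases h : 0 ≤ y₁ 0
      · simp [sg, b, h, abs_of_nonneg h]
      · simp [sg, b, h, abs_of_neg (not_le.1 h)]
    refine mem_iUnion.2 ⟨(j, b), ?_⟩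
    show p e ∈ map 1 j '' S b
    exact ⟨y₁, ⟨(show 2⁻¹ < sg b * y₁ 0 by rw [hsg']; exact hhalf),
      (show sg b * y₁ 0 < 3 / 4 by rw [hsg']; exact mem_ball_zero_iff.1 hy₁)⟩, hje⟩
  -- the difference of the two classes on `O`
  set Δ := singularCohomology.map K K (subsetInclusion inter_subset_left : C(↥O, ↥(p ⁻¹' D))) k YD -
    singularCohomology.map K K (subsetInclusion inter_subset_right : C(↥O, ↥(p ⁻¹' Bs))) k YB with hΔ
  have hΔ0 : Δ = 0 := by
    refine eq_zero_of_forall_res_eq_zero K hPO hPopen hPdisj hPcov Δ fun q => ?_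
    haveI : ContractibleSpace ↥(P q) :=
      contractibleSpace_image q.1 (hSconv q.2) ⟨_, hmid q.2⟩ (by norm_num) (hSr q.2)
    have hb₀ : map 1 q.1 (fun _ => sg q.2 * (5 / 8)) ∈ P q := ⟨_, hmid q.2, rfl⟩
    apply (bijective_res_singleton K hp hb₀ k).1
    rw [map_zero, hΔ, map_sub, map_sub]
    have hn : ‖(fun _ => sg q.2 * (5 / 8) : Fin 1 → ℝ)‖ = 5 / 8 := by
      rw [hSnorm q.2 _ (hmid q.2)]
      have h2 : sg q.2 * sg q.2 = 1 := by cases q.2 <;> simp [sg]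
      linear_combination (5 / 8 : ℝ) * h2
    have hD' : singularCohomology.map K K (subsetInclusion (fibre_subset_preimage hb₀)) k
        (singularCohomology.map K K (subsetInclusion (hPO q)) k
          (singularCohomology.map K K (subsetInclusion inter_subset_left : C(↥O, ↥(p ⁻¹' D))) k YD)) =
        y (map 1 q.1 fun _ => sg q.2 * (5 / 8)) := by
      rw [← ModuleCat.comp_apply, ← ModuleCat.comp_apply, ← singularCohomology.map_comp,
        ← singularCohomology.map_comp]
      exact hYDarc q.1 _ (by rw [hn]; norm_num) (by rw [hn]; norm_num)
    have hB' : singularCohomology.map K K (subsetInclusion (fibre_subset_preimage hb₀)) k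
        (singularCohomology.map K K (subsetInclusion (hPO q)) k
          (singularCohomology.map K K (subsetInclusion inter_subset_right : C(↥O, ↥(p ⁻¹' Bs))) k YB)) =
        y (map 1 q.1 fun _ => sg q.2 * (5 / 8)) := by
      rw [← ModuleCat.comp_apply, ← ModuleCat.comp_apply, ← singularCohomology.map_comp,
        ← singularCohomology.map_comp]
      exact hYBb _ (hPBs q hb₀)
    rw [hD', hB', sub_self]
  have hab : singularCohomology.map K K (subsetInclusion inter_subset_left : C(↥O, ↥(p ⁻¹' D))) k YD =
      singularCohomology.map K K (subsetInclusion inter_subset_right : C(↥O, ↥(p ⁻¹' Bs))) k YB :=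
    sub_eq_zero.1 (hΔ ▸ hΔ0)
  -- (4) Mayer–Vietoris on `p⁻¹X¹ = p⁻¹D ∪ p⁻¹Bs`
  have hA : ∃ A' : Set E, IsOpen A' ∧ p ⁻¹' D = p ⁻¹' X1 ∩ A' :=
    ⟨(p ⁻¹' ⋃ j : cell (univ : Set X) 1, map 1 j '' closedBall (0 : Fin 1 → ℝ) 2⁻¹)ᶜ,
      (isClosed_iUnion_image_closedBall_half.preimage hp.continuous).isOpen_compl, by
        exact Set.ext fun _ => Iff.rfl⟩
  have hB : ∃ B' : Set E, IsOpen B' ∧ p ⁻¹' Bs = p ⁻¹' X1 ∩ B' := by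
    choose W hWo hW using fun j : cell (univ : Set X) 1 => exists_isOpen_inter_eq_image j isOpen_ball hb34
    refine ⟨p ⁻¹' ⋃ j, W j, (isOpen_iUnion hWo).preimage hp.continuous, ?_⟩
    rw [← preimage_inter, inter_iUnion]
    congr 1
    exact iUnion_congr fun j => (hW j).symm
  have hcov : p ⁻¹' X1 ⊆ p ⁻¹' D ∪ p ⁻¹' Bs := fun e he => by
    rcases mem_skeletonLT_succ_iff.1 he with h | ⟨j, y₁, hy₁, hje⟩
    · exact Or.inl (hX0D h)
    · by_cases h34 : ‖y₁‖ < 3 / 4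
      · exact Or.inr (mem_iUnion.2 ⟨j, y₁, mem_ball_zero_iff.2 h34, hje.symm⟩)
      · left
        show p e ∈ D
        rw [hje]
        exact map_mem_D j (lt_of_lt_of_le (by norm_num) (not_lt.1 h34)) (mem_ball_zero_iff.1 hy₁).le
  obtain ⟨w, hwD, -⟩ := exists_of_res_eq_res K (preimage_mono hDX1) (preimage_mono hBsX1) hA hB hcov YD YB hab
  refine ⟨w, fun v hv => ?_⟩
  rw [← res_res K hDX1 (hX0D hv) w, hwD]
  exact hYDv v hv

end OneSkeleton

/-! ### The theorem over a CW base -/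

section CWBase

variable (K : Type u) [Field K]
variable {X : Type u} [TopologicalSpace X] [T2Space X] [CWComplex (univ : Set X)]
variable {E : Type u} [TopologicalSpace E] {p : E → X} (hp : IsSerreFibration p)
  (η : singularCohomology K K E 2) {n₀ : ℕ}
  (hHL : ∀ (x : X) (lo i : ℕ), lo + i = n₀ → i ≤ n₀ →
    Bijective (iterDown (V := fun k => singularHomology K K ↥(p ⁻¹' {x}) k)
      (fun k => capProduct (show 2 + k = k + 2 by omega)
        (singularCohomology.map K K (subsetIncl (p ⁻¹' {x})) 2 η)) i lo))
  (hvan : ∀ (x : X) (k : ℕ), 2 * n₀ < k → ∀ c : singularHomology K K ↥(p ⁻¹' {x}) k, c = 0)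
  {k : ℕ} (y : ∀ x : X, singularCohomology K K ↥(p ⁻¹' {x}) k)
  (hy : ∀ x₀ : X, ∃ V ∈ 𝓝 x₀, ∃ g : singularCohomology K K ↥(p ⁻¹' V) k, ∀ (x : X) (hx : x ∈ V),
    singularCohomology.map K K (subsetInclusion (fibre_subset_preimage hx)) k g = y x)

omit [TopologicalSpace X] [T2Space X] [CWComplex (univ : Set X)] in
/-- Transport of `z|_{p⁻¹b} = y_b` (for a class on `E`) along an equality of base points.
[folklore] -/
theorem resE_eq_iff_of_eq (z : singularCohomology K K E k) {b b' : X} (e : b = b') :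
    (singularCohomology.map K K (subsetIncl (p ⁻¹' {b})) k z = y b ↔
      singularCohomology.map K K (subsetIncl (p ⁻¹' {b'})) k z = y b') := by
  subst e
  exact Iff.rfl

include hp hHL hvan hy in
/-- **Deligne's invariant cycle theorem for a Serre fibration over a Hausdorff CW complex**
(topological form of Voisin II, Thm. 4.18): under fibrewise hard Lefschetz for `η ⌢ ·`, every flat
family `y_x ∈ Hᵏ(p⁻¹x; K)` is the family of fibre restrictions of one class `z ∈ Hᵏ(E; K)`.
Proof: extend `y` over `E₁` (`exists_extension_oneSkeleton`), use the dualised edge theorem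
`range(Hᵏ(E) → Hᵏ(E₀)) = range(Hᵏ(E₁) → Hᵏ(E₀))` (`SerreHardLefschetz.ker_map_eq_ker_map`,
`SerreFlat.range_cohomologyMap_eq_of_ker_eq`) to find `z` with the right restrictions over the
`0`-cells, and propagate along paths to all points (`exists_joined_zeroCell`, `SerreFlat.propagate_univ`).
[cite: VoisinHodgeII2003, Thm. 4.15 and Thm. 4.18] [cite: Deligne1968, Thm. 1.5 and Prop. 2.1] -/
theorem exists_class_of_flat_cw :
    ∃ z : singularCohomology K K E k, ∀ x : X,
      singularCohomology.map K K (subsetIncl (p ⁻¹' {x})) k z = y x := by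
  obtain ⟨w, hw⟩ := exists_extension_oneSkeleton K hp y hy
  have h01 : tot p 0 ⊆ tot p 1 := SerreSkeleta.monotone_tot p (Nat.le_succ 0)
  -- the dualised edge theorem
  have hker : LinearMap.ker (singularHomology.map K K (subsetIncl (tot p 0)) k).hom =
      LinearMap.ker (singularHomology.map K K (subsetInclusion h01) k).hom :=
    SerreHardLefschetz.ker_map_eq_ker_map K hp η hHL hvan k
  have hrange := range_cohomologyMap_eq_of_ker_eq K (subsetIncl (tot p 0)) (subsetInclusion h01) k hker
  have hmem : singularCohomology.map K K (subsetInclusion h01) k w ∈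
      LinearMap.range (singularCohomology.map K K (subsetIncl (tot p 0)) k).hom := by
    rw [hrange]; exact LinearMap.mem_range.2 ⟨w, rfl⟩
  obtain ⟨z, hz⟩ := LinearMap.mem_range.1 hmem
  refine ⟨z, fun x => ?_⟩
  -- at the `0`-cells
  have hX0 : (skeletonLT (univ : Set X) (((0 : ℕ) : ℕ∞) + 1) : Set X) =
      (skeletonLT (univ : Set X) ((1 : ℕ) : ℕ∞) : Set X) := by norm_num
  have h0 : ∀ (v : X) (hv : v ∈ (skeletonLT (univ : Set X) ((1 : ℕ) : ℕ∞) : Set X)),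
      singularCohomology.map K K (subsetIncl (p ⁻¹' {v})) k z = y v := by
    intro v hv
    have hv0 : p ⁻¹' {v} ⊆ tot p 0 := fibre_subset_preimage (C := (skeletonLT (univ : Set X)
      (((0 : ℕ) : ℕ∞) + 1) : Set X)) (by rw [hX0]; exact hv)
    have hfac : subsetIncl (p ⁻¹' {v}) = (subsetIncl (tot p 0)).comp (subsetInclusion hv0) :=
      ContinuousMap.ext fun _ => rfl
    rw [hfac, singularCohomology.map_comp, ModuleCat.comp_apply]
    change singularCohomology.map K K (subsetInclusion hv0) k
      ((singularCohomology.map K K (subsetIncl (tot p 0)) k).hom z) = y v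
    rw [hz, ← ModuleCat.comp_apply, ← singularCohomology.map_comp]
    exact hw v hv
  -- propagate from a `0`-cell
  obtain ⟨v, hv, ⟨γ⟩⟩ := exists_joined_zeroCell x
  have e0 : (γ.symm : C(I, X)) 0 = v := γ.symm.source
  have e1 : (γ.symm : C(I, X)) 1 = x := γ.symm.target
  have hstart := (resE_eq_iff_of_eq K y z e0).2 (h0 v hv)
  exact (resE_eq_iff_of_eq K y z e1).1 (propagate_univ K hp z y hy (γ.symm : C(I, X)) hstart 1)

end CWBase

/-! ### The theorem over a base of the weak homotopy type of a CW complex -/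

section General

variable (K : Type u) [Field K]
variable {B : Type u} [TopologicalSpace B] {E : Type u} [TopologicalSpace E] {p : E → B}
  (hp : IsSerreFibration p)
  {X : Type u} [TopologicalSpace X] [T2Space X] [CWComplex (univ : Set X)] (h : C(X, B))
  (hh : IsWeakHomotopyEquiv h)
  (η : singularCohomology K K E 2) {n₀ : ℕ}
  (hHL : ∀ (b : B) (lo i : ℕ), lo + i = n₀ → i ≤ n₀ →
    Bijective (iterDown (V := fun k => singularHomology K K ↥(p ⁻¹' {b}) k)
      (fun k => capProduct (show 2 + k = k + 2 by omega)
        (singularCohomology.map K K (subsetIncl (p ⁻¹' {b})) 2 η)) i lo))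
  (hvan : ∀ (b : B) (k : ℕ), 2 * n₀ < k → ∀ c : singularHomology K K ↥(p ⁻¹' {b}) k, c = 0)
  {k : ℕ} (y : ∀ b : B, singularCohomology K K ↥(p ⁻¹' {b}) k)
  (hy : ∀ b₀ : B, ∃ V ∈ 𝓝 b₀, ∃ g : singularCohomology K K ↥(p ⁻¹' V) k, ∀ (b : B) (hb : b ∈ V),
    singularCohomology.map K K (subsetInclusion (fibre_subset_preimage hb)) k g = y b)

include hp hh hHL hvan hy in
/-- `exists_class_of_flat` with the pullback `h^*E → X` abstracted: any Serre fibration `p' : E' → X`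
with a weak equivalence `snd : E' → E` over `h` identifying the fibres. [cite: VoisinHodgeII2003, Thm. 4.18]
[cite: Spanier1981, Ch. 9, Sec. 2, Thm. 17] -/
theorem exists_class_of_flat_aux {E' : Type u} [TopologicalSpace E'] {p' : E' → X}
    (hp' : IsSerreFibration p') (snd : C(E', E)) (hsnd : IsWeakHomotopyEquiv snd)
    (hpsnd : ∀ e, p (snd e) = h (p' e))
    (φ : ∀ x : X, ↥(p' ⁻¹' {x}) ≃ₜ ↥(p ⁻¹' {h x}))
    (hφ : ∀ (x : X) (e : ↥(p' ⁻¹' {x})), ((φ x e : ↥(p ⁻¹' {h x})) : E) = snd e.1) :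
    ∃ z : singularCohomology K K E k, ∀ b : B,
      singularCohomology.map K K (subsetIncl (p ⁻¹' {b})) k z = y b := by
  have hφfac : ∀ x : X, snd.comp (subsetIncl (p' ⁻¹' {x})) = (subsetIncl (p ⁻¹' {h x})).comp (φ x : C(↥(p' ⁻¹' {x}), ↥(p ⁻¹' {h x}))) :=
    fun x => ContinuousMap.ext fun e => (hφ x e).symm
  -- the data on `E'`
  let η' : singularCohomology K K E' 2 := singularCohomology.map K K snd 2 η
  let y' : ∀ x : X, singularCohomology K K ↥(p' ⁻¹' {x}) k := fun x =>
    singularCohomology.map K K (φ x : C(↥(p' ⁻¹' {x}), ↥(p ⁻¹' {h x}))) k (y (h x))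
  have hη' : ∀ x : X, singularCohomology.map K K (subsetIncl (p' ⁻¹' {x})) 2 η' =
      singularCohomology.map K K (φ x : C(↥(p' ⁻¹' {x}), ↥(p ⁻¹' {h x}))) 2 (singularCohomology.map K K (subsetIncl (p ⁻¹' {h x})) 2 η) := by
    intro x
    change singularCohomology.map K K (subsetIncl (p' ⁻¹' {x})) 2 (singularCohomology.map K K snd 2 η) = _
    rw [← ModuleCat.comp_apply, ← singularCohomology.map_comp, hφfac x, singularCohomology.map_comp,
      ModuleCat.comp_apply]
  have hHL' : ∀ (x : X) (lo i : ℕ), lo + i = n₀ → i ≤ n₀ →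
      Bijective (iterDown (V := fun k => singularHomology K K ↥(p' ⁻¹' {x}) k)
        (fun k => capProduct (show 2 + k = k + 2 by omega)
          (singularCohomology.map K K (subsetIncl (p' ⁻¹' {x})) 2 η')) i lo) := by
    intro x lo i hloi hi
    rw [hη' x]
    have hcomm : ∀ (m : ℕ) (c : singularHomology K K ↥(p' ⁻¹' {x}) (m + 2)),
        (singularHomology.map K K (φ x : C(↥(p' ⁻¹' {x}), ↥(p ⁻¹' {h x}))) m).hom
          (capProduct (show 2 + m = m + 2 by omega)
            (singularCohomology.map K K (φ x : C(↥(p' ⁻¹' {x}), ↥(p ⁻¹' {h x}))) 2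
              (singularCohomology.map K K (subsetIncl (p ⁻¹' {h x})) 2 η)) c) =
        capProduct (show 2 + m = m + 2 by omega)
          (singularCohomology.map K K (subsetIncl (p ⁻¹' {h x})) 2 η)
          ((singularHomology.map K K (φ x : C(↥(p' ⁻¹' {x}), ↥(p ⁻¹' {h x}))) (m + 2)).hom c) := fun m c =>
      capProduct_map (φ x : C(↥(p' ⁻¹' {x}), ↥(p ⁻¹' {h x}))) (show 2 + m = m + 2 by omega)
        (singularCohomology.map K K (subsetIncl (p ⁻¹' {h x})) 2 η) c
    have hbij : ∀ m, Bijective (singularHomology.map K K (φ x : C(↥(p' ⁻¹' {x}), ↥(p ⁻¹' {h x}))) m).hom := fun m => by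
      haveI := isIso_singularHomology_map_of_isWeakHomotopyEquiv K _ (IsWeakHomotopyEquiv.of_homeomorph (φ x)) m
      exact bijective_hom_of_isIso (singularHomology.map K K (φ x : C(↥(p' ⁻¹' {x}), ↥(p ⁻¹' {h x}))) m)
    have key := bijective_iterDown_iff_of_conj
      (V := fun k => singularHomology K K ↥(p' ⁻¹' {x}) k)
      (V' := fun k => singularHomology K K ↥(p ⁻¹' {h x}) k)
      (fun k => capProduct (show 2 + k = k + 2 by omega)
        (singularCohomology.map K K (φ x : C(↥(p' ⁻¹' {x}), ↥(p ⁻¹' {h x}))) 2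
          (singularCohomology.map K K (subsetIncl (p ⁻¹' {h x})) 2 η)))
      (fun k => capProduct (show 2 + k = k + 2 by omega)
        (singularCohomology.map K K (subsetIncl (p ⁻¹' {h x})) 2 η))
      (fun k => (singularHomology.map K K (φ x : C(↥(p' ⁻¹' {x}), ↥(p ⁻¹' {h x}))) k).hom) hbij hcomm i lo
    exact key.2 (hHL (h x) lo i hloi hi)
  have hvan' : ∀ (x : X) (k : ℕ), 2 * n₀ < k → ∀ c : singularHomology K K ↥(p' ⁻¹' {x}) k, c = 0 := by
    intro x k hk c
    haveI := isIso_singularHomology_map_of_isWeakHomotopyEquiv K _ (IsWeakHomotopyEquiv.of_homeomorph (φ x)) k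
    apply (bijective_hom_of_isIso (singularHomology.map K K (φ x : C(↥(p' ⁻¹' {x}), ↥(p ⁻¹' {h x}))) k)).1
    rw [map_zero]
    exact hvan (h x) k hk _
  have hy' : ∀ x₀ : X, ∃ V ∈ 𝓝 x₀, ∃ g : singularCohomology K K ↥(p' ⁻¹' V) k, ∀ (x : X) (hx : x ∈ V),
      singularCohomology.map K K (subsetInclusion (fibre_subset_preimage hx)) k g = y' x := by
    intro x₀
    obtain ⟨V, hV, g, hg⟩ := hy (h x₀)
    have hmemV : ∀ e : ↥(p' ⁻¹' (h ⁻¹' V)), snd e.1 ∈ p ⁻¹' V := fun e => by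
      have he : h (p' e.1) ∈ V := e.2
      show p (snd e.1) ∈ V
      rw [hpsnd]; exact he
    let sV : C(↥(p' ⁻¹' (h ⁻¹' V)), ↥(p ⁻¹' V)) :=
      ⟨fun e => ⟨snd e.1, hmemV e⟩, (snd.continuous.comp continuous_subtype_val).subtype_mk _⟩
    refine ⟨h ⁻¹' V, h.continuous.continuousAt.preimage_mem_nhds hV, singularCohomology.map K K sV k g,
      fun x hx => ?_⟩
    have hfac : sV.comp (subsetInclusion (fibre_subset_preimage hx)) =
        (subsetInclusion (fibre_subset_preimage hx : p ⁻¹' {h x} ⊆ p ⁻¹' V)).comp (φ x : C(↥(p' ⁻¹' {x}), ↥(p ⁻¹' {h x}))) :=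
      ContinuousMap.ext fun e => Subtype.ext (hφ x _).symm
    change _ = singularCohomology.map K K (φ x : C(↥(p' ⁻¹' {x}), ↥(p ⁻¹' {h x}))) k (y (h x))
    rw [← ModuleCat.comp_apply, ← singularCohomology.map_comp, hfac, singularCohomology.map_comp,
      ModuleCat.comp_apply, hg (h x) hx]
  -- the theorem over the CW base, and descent of the class along `snd`
  obtain ⟨z', hz'⟩ := exists_class_of_flat_cw K hp' η' hHL' hvan' y' hy'
  obtain ⟨z, rfl⟩ := (bijective_cohomologyMap_of_isWeakHomotopyEquiv K snd hsnd k).2 z'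
  refine ⟨z, fun b => ?_⟩
  have hat : ∀ x : X, singularCohomology.map K K (subsetIncl (p ⁻¹' {h x})) k z = y (h x) := by
    intro x
    apply (bijective_cohomologyMap_homeomorph K (φ x) k).1
    rw [← ModuleCat.comp_apply, ← singularCohomology.map_comp, ← hφfac x, singularCohomology.map_comp,
      ModuleCat.comp_apply]
    exact hz' x
  -- every point of `B` is joined to some `h x`
  obtain ⟨q, hq⟩ := hh.1.2 (ZerothHomotopy.mk b)
  induction q using Quotient.inductionOn with
  | h x =>
    have hx : ZerothHomotopy.mk (h x) = ZerothHomotopy.mk b := by rw [← hq]; rfl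
    obtain ⟨γ⟩ : Joined (h x) b := Quotient.exact hx
    have e0 : (γ : C(I, B)) 0 = h x := γ.source
    have e1 : (γ : C(I, B)) 1 = b := γ.target
    have hstart := (resE_eq_iff_of_eq K y z e0).2 (hat x)
    exact (resE_eq_iff_of_eq K y z e1).1 (propagate_univ K hp z y hy (γ : C(I, B)) hstart 1)

include hp hh hHL hvan hy in
/-- **Deligne's invariant cycle theorem for Serre fibrations** (topological form of Voisin II,
Thm. 4.18; Deligne 1968): let `p : E → B` be a Serre fibration over a base weakly equivalent to a
Hausdorff CW complex, `K` a field and `η ∈ H²(E; K)` a class whose restriction to every fibre has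
the hard Lefschetz property for the cap product (`(η| ⌢ ·)ⁱ : H_{n₀+i}(p⁻¹b) ≅ H_{n₀-i}(p⁻¹b)`,
`H_k(p⁻¹b) = 0` for `k > 2n₀`). Then every flat family `y_b ∈ Hᵏ(p⁻¹b; K)` — every global
section of `Rᵏ p_* K` — is the family of restrictions of a class `z ∈ Hᵏ(E; K)`: "the restriction
map `Hᵏ(X, ℚ) → H⁰(Y, Rᵏ φ_* ℚ)` … is surjective". Pull back to the CW model (`h^*E → E` is a weak
equivalence, Spanier 9.2.17), apply `exists_class_of_flat_cw`, and propagate along paths from the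
points `h x`. [cite: VoisinHodgeII2003, Thm. 4.15 and Thm. 4.18] [cite: Deligne1968, Thm. 1.5 and Prop. 2.1]
[cite: Spanier1981, Ch. 9, Sec. 2, Thm. 17] -/
theorem exists_class_of_flat :
    ∃ z : singularCohomology K K E k, ∀ b : B,
      singularCohomology.map K K (subsetIncl (p ⁻¹' {b})) k z = y b := by
  have hp' : IsSerreFibration (Function.Pullback.fst : (⇑h).Pullback p → X) := hp.pullback_fst h
  have hsnd := hp.isWeakHomotopyEquiv_pullback_snd h hh
  have hmemφ : ∀ (x : X) (e : ↥((Function.Pullback.fst : (⇑h).Pullback p → X) ⁻¹' {x})),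
      e.1.snd ∈ p ⁻¹' {h x} := fun x e => by
    have he : e.1.fst = x := e.2
    have h2 : h e.1.fst = p e.1.snd := e.1.2
    rw [he] at h2
    exact h2.symm
  refine exists_class_of_flat_aux K hp h hh η hHL hvan y hy hp' _ hsnd (fun e => e.2.symm)
    (fun x =>
      { toFun := fun e => ⟨e.1.snd, hmemφ x e⟩
        invFun := fun e => ⟨⟨(x, e.1), (e.2 : p e.1 = h x).symm⟩, rfl⟩
        left_inv := fun e => by
          apply Subtype.ext; apply Subtype.ext; apply Prod.ext
          · exact (e.2 : e.1.fst = x).symm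
          · rfl
        right_inv := fun e => rfl
        continuous_toFun :=
          ((continuous_snd.comp continuous_subtype_val).comp continuous_subtype_val).subtype_mk _
        continuous_invFun := ((continuous_const.prodMk continuous_subtype_val).subtype_mk _).subtype_mk _ })
    (fun x e => rfl)

end General

universe v

/-! ### Hard Lefschetz: from the cup product to the cap product -/

section CupCap

variable (K : Type v) [Field K] {F : Type u} [TopologicalSpace F]

/-- `⟨Lⁱ a, c⟩ = ⟨a, (κ ⌢ ·)ⁱ c⟩`: the iterated Lefschetz operator is adjoint to the iterated cap
product under the Kronecker pairing (induction on `i` from `⟨κ ⌣ b, c⟩ = ⟨b, κ ⌢ c⟩`).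
[cite: HatcherAT2002, §3.3 p. 241] -/
theorem kroneckerPairing_lefschetzPow (κ : singularCohomology K K F 2) :
    ∀ (i lo : ℕ) (a : singularCohomology K K F lo) (c : singularHomology K K F (lo + 2 * i)),
      kroneckerPairing K K F (lo + 2 * i) (lefschetzPow κ i lo a) c =
        kroneckerPairing K K F lo a
          (iterDown (V := fun k => singularHomology K K F k)
            (fun k => capProduct (show 2 + k = k + 2 by omega) κ) i lo c)
  | 0, lo, a, c => rfl
  | i + 1, lo, a, c => by
    have h2 : 2 + (lo + 2 * i) = lo + 2 * (i + 1) := by omega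
    have hL : lefschetzPow κ (i + 1) lo a = cupProduct h2 κ (lefschetzPow κ i lo a) := rfl
    rw [hL, kroneckerPairing_cupProduct h2 κ (lefschetzPow κ i lo a) c,
      kroneckerPairing_lefschetzPow κ i lo a (capProduct h2 κ c)]
    rfl

/-- **Hard Lefschetz passes from the cup product to the cap product** over a field: if
`Lⁱ : Hˡᵒ(F; K) → H^{lo+2i}(F; K)` is bijective for `lo + i = n₀` (`HasHardLefschetzProperty κ n₀`),
then `(κ ⌢ ·)ⁱ : H_{lo+2i}(F; K) → H_{lo}(F; K)` is bijective (it is the transpose of `Lⁱ` under the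
bijective Kronecker maps, Hatcher Thm. 3.2). [cite: VoisinHodgeI2002, Thm. 6.25]
[cite: HatcherAT2002, §3.1 Thm. 3.2 (p. 198) and §3.3 p. 241] -/
theorem capHardLefschetz_of_hasHardLefschetzProperty (κ : singularCohomology K K F 2) {n₀ : ℕ}
    (h : HasHardLefschetzProperty κ n₀) (lo i : ℕ) (hloi : lo + i = n₀) :
    Bijective (iterDown (V := fun k => singularHomology K K F k)
      (fun k => capProduct (show 2 + k = k + 2 by omega) κ) i lo) := by
  set Λ := iterDown (V := fun k => singularHomology K K F k)
    (fun k => capProduct (show 2 + k = k + 2 by omega) κ) i lo with hΛ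
  have hL : Bijective (lefschetzPow κ i lo) := h i lo hloi
  let Dlo := LinearEquiv.ofBijective _ (kroneckerPairing_bijective_of_field K F lo)
  let Dhi := LinearEquiv.ofBijective _ (kroneckerPairing_bijective_of_field K F (lo + 2 * i))
  have key : ∀ a, Dhi (lefschetzPow κ i lo a) = Λ.dualMap (Dlo a) := fun a => by
    apply LinearMap.ext
    intro c
    rw [LinearMap.dualMap_apply]
    exact kroneckerPairing_lefschetzPow K κ i lo a c
  have hcomp : (Λ.dualMap : Module.Dual K (singularHomology K K F lo) → _) =
      Dhi ∘ lefschetzPow κ i lo ∘ Dlo.symm := by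
    funext φ
    obtain ⟨a, rfl⟩ := Dlo.surjective φ
    simp only [Function.comp_apply, LinearEquiv.symm_apply_apply, key]
  have hbij : Bijective Λ.dualMap := by
    rw [hcomp]
    exact Dhi.bijective.comp (hL.comp Dlo.symm.bijective)
  exact ⟨LinearMap.dualMap_surjective_iff.1 hbij.2, LinearMap.dualMap_injective_iff.1 hbij.1⟩

end CupCap

/-! ### Bases covered by clopen pieces with CW models -/

section Cover

variable (K : Type u) [Field K]
variable {B : Type u} [TopologicalSpace B] {E : Type u} [TopologicalSpace E] {p : E → B}
  (hp : IsSerreFibration p)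
  {ι : Type v} (Bp : ι → Set B) (hBo : ∀ i, IsOpen (Bp i))
  (hBd : ∀ i j, i ≠ j → Disjoint (Bp i) (Bp j)) (hBc : ∀ b, ∃ i, b ∈ Bp i)
  (hCW : ∀ i, ∃ (X : Type u) (_ : TopologicalSpace X) (_ : T2Space X)
    (_ : CWComplex (univ : Set X)) (h : C(X, ↥(Bp i))), IsWeakHomotopyEquiv h)
  (η : singularCohomology K K E 2) {n₀ : ℕ}
  (hHL : ∀ (b : B) (lo i : ℕ), lo + i = n₀ → i ≤ n₀ →
    Bijective (iterDown (V := fun k => singularHomology K K ↥(p ⁻¹' {b}) k)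
      (fun k => capProduct (show 2 + k = k + 2 by omega)
        (singularCohomology.map K K (subsetIncl (p ⁻¹' {b})) 2 η)) i lo))
  (hvan : ∀ (b : B) (k : ℕ), 2 * n₀ < k → ∀ c : singularHomology K K ↥(p ⁻¹' {b}) k, c = 0)
  {k : ℕ} (y : ∀ b : B, singularCohomology K K ↥(p ⁻¹' {b}) k)
  (hy : ∀ b₀ : B, ∃ V ∈ 𝓝 b₀, ∃ g : singularCohomology K K ↥(p ⁻¹' V) k, ∀ (b : B) (hb : b ∈ V),
    singularCohomology.map K K (subsetInclusion (fibre_subset_preimage hb)) k g = y b)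

include hp hHL hvan hy in
/-- The theorem over one open piece `C` of the base with a CW model: a class on `p⁻¹C` restricting
to `y` on the fibres over `C`. [cite: VoisinHodgeII2003, Thm. 4.15 and Thm. 4.18] -/
theorem exists_class_piece (C : Set B) {X : Type u} [TopologicalSpace X] [T2Space X]
    [CWComplex (univ : Set X)] (h : C(X, ↥C)) (hh : IsWeakHomotopyEquiv h) :
    ∃ z : singularCohomology K K ↥(p ⁻¹' C) k, ∀ (b : B) (hb : b ∈ C),
      singularCohomology.map K K (subsetInclusion (fibre_subset_preimage hb)) k z = y b := by
  have hpC : IsSerreFibration (C.restrictPreimage p) := hp.restrictPreimage C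
  -- the fibres of `p|` are the fibres of `p`
  obtain ⟨e, he⟩ : ∃ e : ∀ x : ↥C, ↥((C.restrictPreimage p) ⁻¹' {x}) ≃ₜ ↥(p ⁻¹' {(x : B)}),
      ∀ (x : ↥C) (u : ↥((C.restrictPreimage p) ⁻¹' {x})), ((e x u : ↥(p ⁻¹' {(x : B)})) : E) = u.1.1 :=
    ⟨fun x =>
      { toFun := fun u => ⟨u.1.1, congrArg Subtype.val u.2⟩
        invFun := fun v =>
          ⟨⟨v.1, Set.mem_preimage.2 (mem_of_eq_of_mem (v.2 : p v.1 = (x : B)) x.2)⟩, Subtype.ext v.2⟩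
        left_inv := fun u => rfl
        right_inv := fun v => rfl
        continuous_toFun := (continuous_subtype_val.comp continuous_subtype_val).subtype_mk _
        continuous_invFun := (continuous_subtype_val.subtype_mk _).subtype_mk _ }, fun x u => rfl⟩
  have hefac : ∀ x : ↥C, (subsetIncl (p ⁻¹' C)).comp (subsetIncl ((C.restrictPreimage p) ⁻¹' {x})) =
      (subsetIncl (p ⁻¹' {(x : B)})).comp (e x : C(↥((C.restrictPreimage p) ⁻¹' {x}), ↥(p ⁻¹' {(x : B)}))) :=
    fun x => ContinuousMap.ext fun u => (he x u).symm
  -- the data over `C`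
  let ηC : singularCohomology K K ↥(p ⁻¹' C) 2 := singularCohomology.map K K (subsetIncl (p ⁻¹' C)) 2 η
  let yC : ∀ x : ↥C, singularCohomology K K ↥((C.restrictPreimage p) ⁻¹' {x}) k := fun x =>
    singularCohomology.map K K (e x : C(↥((C.restrictPreimage p) ⁻¹' {x}), ↥(p ⁻¹' {(x : B)}))) k (y x)
  have hηC : ∀ x : ↥C, singularCohomology.map K K (subsetIncl ((C.restrictPreimage p) ⁻¹' {x})) 2 ηC =
      singularCohomology.map K K (e x : C(↥((C.restrictPreimage p) ⁻¹' {x}), ↥(p ⁻¹' {(x : B)}))) 2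
        (singularCohomology.map K K (subsetIncl (p ⁻¹' {(x : B)})) 2 η) := by
    intro x
    change singularCohomology.map K K (subsetIncl ((C.restrictPreimage p) ⁻¹' {x})) 2
      (singularCohomology.map K K (subsetIncl (p ⁻¹' C)) 2 η) = _
    rw [← ModuleCat.comp_apply, ← singularCohomology.map_comp, hefac x, singularCohomology.map_comp,
      ModuleCat.comp_apply]
  have hHLC : ∀ (x : ↥C) (lo i : ℕ), lo + i = n₀ → i ≤ n₀ →
      Bijective (iterDown (V := fun k => singularHomology K K ↥((C.restrictPreimage p) ⁻¹' {x}) k)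
        (fun k => capProduct (show 2 + k = k + 2 by omega)
          (singularCohomology.map K K (subsetIncl ((C.restrictPreimage p) ⁻¹' {x})) 2 ηC)) i lo) := by
    intro x lo i hloi hi
    rw [hηC x]
    have hcomm : ∀ (m : ℕ) (c : singularHomology K K ↥((C.restrictPreimage p) ⁻¹' {x}) (m + 2)),
        (singularHomology.map K K (e x : C(↥((C.restrictPreimage p) ⁻¹' {x}), ↥(p ⁻¹' {(x : B)}))) m).hom
          (capProduct (show 2 + m = m + 2 by omega)
            (singularCohomology.map K K (e x : C(↥((C.restrictPreimage p) ⁻¹' {x}), ↥(p ⁻¹' {(x : B)}))) 2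
              (singularCohomology.map K K (subsetIncl (p ⁻¹' {(x : B)})) 2 η)) c) =
        capProduct (show 2 + m = m + 2 by omega)
          (singularCohomology.map K K (subsetIncl (p ⁻¹' {(x : B)})) 2 η)
          ((singularHomology.map K K (e x : C(↥((C.restrictPreimage p) ⁻¹' {x}), ↥(p ⁻¹' {(x : B)}))) (m + 2)).hom c) :=
      fun m c => capProduct_map (e x : C(↥((C.restrictPreimage p) ⁻¹' {x}), ↥(p ⁻¹' {(x : B)})))
        (show 2 + m = m + 2 by omega) (singularCohomology.map K K (subsetIncl (p ⁻¹' {(x : B)})) 2 η) c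
    have hbij : ∀ m, Bijective (singularHomology.map K K
        (e x : C(↥((C.restrictPreimage p) ⁻¹' {x}), ↥(p ⁻¹' {(x : B)}))) m).hom := fun m => by
      haveI := isIso_singularHomology_map_of_isWeakHomotopyEquiv K _ (IsWeakHomotopyEquiv.of_homeomorph (e x)) m
      exact bijective_hom_of_isIso (singularHomology.map K K
        (e x : C(↥((C.restrictPreimage p) ⁻¹' {x}), ↥(p ⁻¹' {(x : B)}))) m)
    have key := bijective_iterDown_iff_of_conj
      (V := fun k => singularHomology K K ↥((C.restrictPreimage p) ⁻¹' {x}) k)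
      (V' := fun k => singularHomology K K ↥(p ⁻¹' {(x : B)}) k)
      (fun k => capProduct (show 2 + k = k + 2 by omega)
        (singularCohomology.map K K (e x : C(↥((C.restrictPreimage p) ⁻¹' {x}), ↥(p ⁻¹' {(x : B)}))) 2
          (singularCohomology.map K K (subsetIncl (p ⁻¹' {(x : B)})) 2 η)))
      (fun k => capProduct (show 2 + k = k + 2 by omega)
        (singularCohomology.map K K (subsetIncl (p ⁻¹' {(x : B)})) 2 η))
      (fun k => (singularHomology.map K K
        (e x : C(↥((C.restrictPreimage p) ⁻¹' {x}), ↥(p ⁻¹' {(x : B)}))) k).hom) hbij hcomm i lo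
    exact key.2 (hHL x lo i hloi hi)
  have hvanC : ∀ (x : ↥C) (k : ℕ), 2 * n₀ < k →
      ∀ c : singularHomology K K ↥((C.restrictPreimage p) ⁻¹' {x}) k, c = 0 := by
    intro x k hk c
    haveI := isIso_singularHomology_map_of_isWeakHomotopyEquiv K _ (IsWeakHomotopyEquiv.of_homeomorph (e x)) k
    apply (bijective_hom_of_isIso (singularHomology.map K K
      (e x : C(↥((C.restrictPreimage p) ⁻¹' {x}), ↥(p ⁻¹' {(x : B)}))) k)).1
    rw [map_zero]
    exact hvan x k hk _
  have hyC : ∀ x₀ : ↥C, ∃ V ∈ 𝓝 x₀, ∃ g : singularCohomology K K ↥((C.restrictPreimage p) ⁻¹' V) k,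
      ∀ (x : ↥C) (hx : x ∈ V),
        singularCohomology.map K K (subsetInclusion (fibre_subset_preimage hx)) k g = yC x := by
    intro x₀
    obtain ⟨V, hV, g, hg⟩ := hy x₀
    let sV : C(↥((C.restrictPreimage p) ⁻¹' (Subtype.val ⁻¹' V)), ↥(p ⁻¹' V)) :=
      ⟨fun u => ⟨u.1.1, u.2⟩, (continuous_subtype_val.comp continuous_subtype_val).subtype_mk _⟩
    refine ⟨Subtype.val ⁻¹' V, continuous_subtype_val.continuousAt.preimage_mem_nhds hV,
      singularCohomology.map K K sV k g, fun x hx => ?_⟩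
    have hfac : sV.comp (subsetInclusion (fibre_subset_preimage hx)) =
        (subsetInclusion (fibre_subset_preimage hx : p ⁻¹' {(x : B)} ⊆ p ⁻¹' V)).comp
          (e x : C(↥((C.restrictPreimage p) ⁻¹' {x}), ↥(p ⁻¹' {(x : B)}))) :=
      ContinuousMap.ext fun u => Subtype.ext (he x _).symm
    change _ = singularCohomology.map K K
      (e x : C(↥((C.restrictPreimage p) ⁻¹' {x}), ↥(p ⁻¹' {(x : B)}))) k (y x)
    rw [← ModuleCat.comp_apply, ← singularCohomology.map_comp, hfac, singularCohomology.map_comp,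
      ModuleCat.comp_apply, hg x hx]
  obtain ⟨z, hz⟩ := exists_class_of_flat K hpC h hh ηC hHLC hvanC yC hyC
  refine ⟨z, fun b hb => ?_⟩
  have hx := hz ⟨b, hb⟩
  have hfac : subsetInclusion (fibre_subset_preimage hb) =
      (subsetIncl ((C.restrictPreimage p) ⁻¹' {(⟨b, hb⟩ : ↥C)})).comp
        ((e ⟨b, hb⟩).symm : C(↥(p ⁻¹' {b}), ↥((C.restrictPreimage p) ⁻¹' {(⟨b, hb⟩ : ↥C)}))) := by
    refine ContinuousMap.ext fun v => Subtype.ext ?_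
    have h1 := he ⟨b, hb⟩ ((e ⟨b, hb⟩).symm v)
    rw [Homeomorph.apply_symm_apply] at h1
    exact h1
  rw [hfac, singularCohomology.map_comp, ModuleCat.comp_apply, hx]
  exact map_symm_map_homeomorph K (e ⟨b, hb⟩) k (y b)

include hp hBo hBd hBc hCW hHL hvan hy in
/-- **Deligne's invariant cycle theorem for a Serre fibration over a base covered by pairwise
disjoint open pieces with CW models** (e.g. the equidimensional pieces of the complex points of a
smooth variety): under fibrewise hard Lefschetz for `η ⌢ ·`, every flat family of fibre classes is
the family of restrictions of one class on `E` (the theorem over each piece,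
`exists_class_piece`, glued over the clopen partition `{p⁻¹Bᵢ}` of `E`).
[cite: VoisinHodgeII2003, Thm. 4.15 and Thm. 4.18] [cite: Deligne1968, Thm. 1.5 and Prop. 2.1]
[cite: HatcherAT2002, §3.1 p. 202] -/
theorem exists_class_of_flat_of_cover :
    ∃ z : singularCohomology K K E k, ∀ b : B,
      singularCohomology.map K K (subsetIncl (p ⁻¹' {b})) k z = y b := by
  have hz : ∀ i, ∃ z : singularCohomology K K ↥(p ⁻¹' Bp i) k, ∀ (b : B) (hb : b ∈ Bp i),
      singularCohomology.map K K (subsetInclusion (fibre_subset_preimage hb)) k z = y b := by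
    intro i
    obtain ⟨X, _, _, _, h, hh⟩ := hCW i
    exact exists_class_piece K hp η hHL hvan y hy (Bp i) h hh
  choose z hz using hz
  have hpart : IsClopenPartition fun i => p ⁻¹' Bp i :=
    IsClopenPartition.of_pairwise_disjoint (fun i => (hBo i).preimage hp.continuous)
      (fun i j hij => (hBd i j hij).preimage p)
      (eq_univ_of_forall fun e => by
        obtain ⟨i, hi⟩ := hBc (p e)
        exact mem_iUnion.2 ⟨i, hi⟩)
  obtain ⟨w, hw⟩ := singularCohomology.exists_forall_map_subsetIncl_eq hpart z
  refine ⟨w, fun b => ?_⟩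
  obtain ⟨i, hb⟩ := hBc b
  have hfac : subsetIncl (p ⁻¹' {b}) = (subsetIncl (p ⁻¹' Bp i)).comp (subsetInclusion (fibre_subset_preimage hb)) :=
    ContinuousMap.ext fun _ => rfl
  rw [hfac, singularCohomology.map_comp, ModuleCat.comp_apply, hw i]
  exact hz i b hb

end Cover

end SerreInvariantCycles

end Literature.AlgebraicTopology.Homotopy
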